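/-
Origin: expansion seat `literature-prover-pub-hodgecm-cf-gaoullmo-g2-0`, handover 2026-08-18 (`HOME/pub-hodgecm-cf-gaoullmo-g2/lean/CfGU2/GaoUllmoCrossModel.lean`, md5 b678fb78, 67 lines);
landed by the gen-6 packager in gate run 22 as `HodgeCM/Proofs/Pohlmann/GaoUllmoCrossModel.lean` (import ^import Pohl3\.→import HodgeCM.Proofs.Pohlmann. ×1; import ^import CfGU2\.→import HodgeCM.Proofs.Pohlmann. ×1).
-/
/-
Copyright: pub-hodgecm formalisation cell (harness21, 2026). New file (not vendored).
Seat: literature-prover-pub-hodgecm-cf-gaoullmo-g2-0 (unit pub-hodgecm-cf-gaoullmo-g2, CITED-FACT SEAT (4) Gao–Ullmo, gen 2).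
Suggested place: `HodgeCM/Proofs/Pohlmann/GaoUllmoCrossModel.lean`; lands AFTER pohl-g3's `Proofs/Pohlmann/WeightLines.lean`
(run-22 queue, md5 3dd57e5ceb9b) and this seat's `Proofs/Pohlmann/GaoUllmoDictionary.lean` (run-22 queue, md5 b7767d72095c);
on landing rewrite `import Pohl3.WeightLines` → `import HodgeCM.Proofs.Pohlmann.WeightLines` and
`import CfGU2.GaoUllmoDictionary` → `import HodgeCM.Proofs.Pohlmann.GaoUllmoDictionary`.
-/
import Summits.HodgeConjecture.HodgeCM.Proofs.Pohlmann.WeightLines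
import Summits.HodgeConjecture.HodgeCM.Proofs.Pohlmann.GaoUllmoDictionary_2

/-!
# Cross-model consistency: the package's `B^p(∏_j A_{(F,Θ_j)})` and Gao–Ullmo's have the same `ℚ`-dimension

Two formalisations of Pohlmann's theorem now live in the package, over two different models of the cohomology of
`A′ = ∏_{j ≤ n} A_{(F, Θ_j)}` (`F` a Galois CM field):

* the GEOMETRIC UNIVERSE `U` (abstract `Coh`, `hodge`, `cup`, `pull`; model facts `ModelAxioms` M1–M28 and the four textbook
  facts N1–N4 of `Geometry/CupFacts.lean`): `Universe.finrank_hodgeClassesOf` (pohl-g3, `Proofs/Pohlmann/WeightLines.lean`) —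
  `dim_ℚ B^p(A′) = #{S // IsHodgeWeight Θ p S}` for `p ≥ 1`;
* GAO–ULLMO'S OWN MODEL (`Literature/GaoUllmo.lean`: `H^r = ⋀^r ℂ^S`, `S = Hom(E, ℂ)`, `E = F^{n+1}`, rational structure from
  `H¹ = E`, `H^{p,p} = span{[P] : |P ∩ Φ| = |P ∩ Φ̄| = p}`, `B^p = H^{2p}_ℚ ∩ H^{p,p}`), in which Theorem 3.1 is KERNEL-PROVED with no
  hypothesis (`GaoUllmo.Theorem31_finrank_holds`, cf-gaoullmo gen 1) and read in package vocabulary by the dictionary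
  `GaoUllmo.finrank_Bp_pi_eq_card_hodgeWeight` (cf-gaoullmo gen 2): `dim_ℚ B^p = #{S // IsHodgeWeight Θ p S}`.

Hence the two models assign the SAME dimension to the space of Hodge classes of `A′` in every positive codimension —
`finrank_hodgeClassesOf_eq_finrank_Bp` below (hypotheses: `ModelAxioms`, N1–N4 on the `U` side; nothing on the Gao–Ullmo side;
any linear order on `Hom(E, ℂ)` obeying the paper's convention, which exists by `GaoUllmo.exists_orderConvention`).
This is a consistency statement between two typings, not a new mathematical fact; it is recorded because the cell's rule asks
for kernel evidence wherever a dictionary between a cited theorem and a package statement is claimed (GAPS cf-gaoullmo-G1).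
(`p = 0`: `B⁰ ⊗ ℂ = H⁰`; `dim H⁰(A′) = 1` is connectedness, not a recorded model fact — excluded on the `U` side, as in pohl-g3.)
-/

noncomputable section

namespace HodgeCM

namespace Universe

open Literature.AlgebraicGeometry.Motives (CMType)
open HodgeCM.GaoUllmo

variable {U : Universe}

/-- **Cross-model consistency.** For a Galois CM field `F`, CM types `Θ_0, …, Θ_n` and `p ≥ 1`: the `ℚ`-dimension of the Hodge
classes of `∏_j A_{(F,Θ_j)}` in the geometric universe (`ModelAxioms` + N1–N4) equals the `ℚ`-dimension of `B^p` in Gao–Ullmo's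
model of the same CM abelian variety `A_{(F^{n+1}, ⊔_j Θ_j)}` (no hypothesis) — both being the number of Hodge weights. -/
theorem finrank_hodgeClassesOf_eq_finrank_Bp (M : U.ModelAxioms) (hN1 : U.Fact_cupExterior) (hN2 : U.Fact_cup_hodge)
    (hN3 : U.Fact_pull_H0) (hN4 : U.Fact_hodge_F0) (F : CMField) [IsGalois ℚ F] {n : ℕ} (Θ : Fin (n + 1) → CMType F)
    [LinearOrder (Emb (Fin (n + 1) → (F : Type)))] (hord : OrderConvention (piCMType Θ)) {p : ℕ} (hp : 0 < p) :
    Module.finrank ℚ (U.hodgeClassesOf (U.cmProd F Θ) p) = Module.finrank ℚ (Bp (piCMType Θ) p) := by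
  rw [finrank_hodgeClassesOf (F := F) (n := n) (Θ := Θ) M hN1 hN2 hN3 hN4 hp,
    finrank_Bp_pi_eq_card_hodgeWeight Θ hord p]

/-- The same, with the order convention discharged: for SOME admissible ordering of `Hom(F^{n+1}, ℂ)` (one always exists,
`GaoUllmo.exists_orderConvention`) the two dimensions agree. -/
theorem exists_order_finrank_hodgeClassesOf_eq_finrank_Bp (M : U.ModelAxioms) (hN1 : U.Fact_cupExterior)
    (hN2 : U.Fact_cup_hodge) (hN3 : U.Fact_pull_H0) (hN4 : U.Fact_hodge_F0) (F : CMField) [IsGalois ℚ F] {n : ℕ}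
    (Θ : Fin (n + 1) → CMType F) {p : ℕ} (hp : 0 < p) :
    ∃ r : LinearOrder (Emb (Fin (n + 1) → (F : Type))), @OrderConvention _ _ _ r (piCMType Θ) ∧
      Module.finrank ℚ (U.hodgeClassesOf (U.cmProd F Θ) p) = Module.finrank ℚ (@Bp _ _ _ _ r (piCMType Θ) p) := by
  obtain ⟨r, hr⟩ := exists_orderConvention (piCMType Θ)
  exact ⟨r, hr, @finrank_hodgeClassesOf_eq_finrank_Bp U M hN1 hN2 hN3 hN4 F _ n Θ r hr p hp⟩

end Universe

end HodgeCM
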